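import Mathlib.Analysis.Fourier.FourierTransformDeriv
import Mathlib.Analysis.SpecialFunctions.JapaneseBracket
import Literature.NumberTheory.LFunctions.DedekindZetaThetaProofs
import HarnessLib

/-!
# The Fourier transform of a polynomial times the Gaussian: `𝓕[∏ᵢ ⟨x, eᵢ⟩ e^{-π‖x‖²}]`

Topic `Literature/NumberTheory/LFunctions` (next to the Poisson summation and Gaussian lemmas of
`DedekindZetaPoissonProofs.lean` / `DedekindZetaThetaProofs.lean`, which it reuses); namespace
`Literature.NumberTheory.LFunctions.Fourier`.

On a finite-dimensional real inner product space `V`, the Gaussian `G(x) = e^{-π‖x‖²}` is its own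
Fourier transform (`𝓕 f(ξ) = ∫ f(x) e^{-2πi⟨x,ξ⟩} dx`, Mathlib `fourier_gaussian_innerProductSpace`),
and for a finite family of *pairwise orthogonal* vectors `e₁, …, e_k` the "harmonic" polynomial
multiple `P(x) G(x)`, `P(x) = ∏ᵢ ⟨x, eᵢ⟩`, satisfies

  `𝓕[P G] = (-i)^k P G`        (`fourier_polyGaussian`).

This is the analytic input of Hecke's theta transformation formula with "Größencharacter
weights" `N(x^p)` at real places (Hecke 1920; Neukirch, *Algebraic Number Theory*, VII (3.3)
Proposition: the functions `f_p(a, b, x) = N((x+a)^p) e^{-π⟨a+x,a+x⟩ + 2πi⟨b,x⟩}` satisfy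
`f̂ = [i^{Tr(p)} e^{2πi⟨a,b⟩}]⁻¹ f_p(-b, a, ·)`, proved there by differentiating the case `p = 0` in
`a`; here `b = 0`, and `a = 0` resp. `a = x₀`), in the form needed for the continuation of the
L-series of ray class characters (`NumberTheory/LFunctions`).

## Proof

Induction on the family: if `𝓕 f = c f` for `f = P G` and `e` is orthogonal to the `eᵢ`, then
differentiating `𝓕 f` in the direction `e` (Mathlib `Real.hasFDerivAt_fourier`:
`∂_e 𝓕 f = 𝓕[-2πi ⟨x, e⟩ f]`) and computing `∂_e (P G) = P ∂_e G = -2π ⟨x, e⟩ P G` along the line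
`ξ + te` (`P` is constant on it by orthogonality) gives `𝓕[⟨x,e⟩ f] = -i c ⟨ξ, e⟩ f`.

## Mathlib search

Mathlib (this pin) has the Gaussian Fourier transform in inner product spaces
(`fourier_gaussian_innerProductSpace'`, with a linear phase but no polynomial weight), the
derivative of the Fourier transform (`Real.hasFDerivAt_fourier`, `fourierSMulRight`) and
`integrable_one_add_norm`; no Hermite functions / polynomial-times-Gaussian transforms
(grep `hermite`: only `Polynomial.hermite`, algebraic).  From the tree we reuse
`NumberField.fourier_gaussian_pi_eq_self` and `NumberField.exp_neg_mul_sq_le`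
(`DedekindZetaThetaProofs.lean`); the Gaussian is written, as there, as the lambda
`fun v ↦ ((Real.exp (-π * ‖v‖ ^ 2) : ℝ) : ℂ)` (no new name: the tree also has it as
`Literature.Analysis.FunctionSpaces.gaussianSchwartz V π` and
`Literature.Algebra.EuclideanLattices.gaussianFunction 1`, whose imports are not needed here).
`polyGaussian` is new (no polynomial-times-Gaussian transforms in Mathlib or the tree).

## References

* J. Neukirch, *Algebraic Number Theory*, Grundlehren 322, Springer 1999, Ch. VII §3, (3.1)
  Proposition and (3.3) Proposition. [NeukirchANT1999]
* E. Hecke, *Eine neue Art von Zetafunktionen und ihre Beziehungen zur Verteilung der Primzahlen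
  II*, Math. Z. 6 (1920), 11–51. [HeckeMathZ1920]
-/

noncomputable section

open MeasureTheory VectorFourier
open scoped FourierTransform RealInnerProductSpace Real

namespace Literature.NumberTheory.LFunctions.Fourier

variable {V : Type*} [NormedAddCommGroup V] [InnerProductSpace ℝ V] [FiniteDimensional ℝ V]
  [MeasurableSpace V] [BorelSpace V]

/-! ### Gaussian versus powers: integrability of `‖x‖^k e^{-π‖x‖²}` -/

omit [InnerProductSpace ℝ V] [FiniteDimensional ℝ V] [MeasurableSpace V] [BorelSpace V] in
/-- `‖x‖^k e^{-π‖x‖²} ≤ C (1 + ‖x‖)^{-c}` for every `c ≥ 0`, with `C = e^{(k+c)²/(4π)}`. [folklore] -/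
theorem norm_pow_mul_exp_le (k : ℕ) {c : ℝ} (hc : 0 ≤ c) (v : V) :
    ‖v‖ ^ k * Real.exp (-π * ‖v‖ ^ 2) ≤
      Real.exp (((k : ℝ) + c) ^ 2 / (4 * π)) * (1 + ‖v‖) ^ (-c) := by
  have h0 : 0 ≤ ‖v‖ := norm_nonneg v
  have h1 : ‖v‖ ^ k ≤ (1 + ‖v‖) ^ (k : ℝ) := by
    rw [Real.rpow_natCast]
    exact pow_le_pow_left₀ h0 (by linarith) k
  have h2 := NumberField.exp_neg_mul_sq_le Real.pi_pos (by positivity : 0 ≤ (k : ℝ) + c) h0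
  have hpos : 0 < 1 + ‖v‖ := by positivity
  calc ‖v‖ ^ k * Real.exp (-π * ‖v‖ ^ 2)
      ≤ (1 + ‖v‖) ^ (k : ℝ) * (Real.exp (((k : ℝ) + c) ^ 2 / (4 * π)) * (1 + ‖v‖) ^ (-((k : ℝ) + c))) :=
        mul_le_mul h1 h2 (Real.exp_pos _).le (by positivity)
    _ = Real.exp (((k : ℝ) + c) ^ 2 / (4 * π)) * (1 + ‖v‖) ^ (-c) := by
        rw [mul_left_comm, ← Real.rpow_add hpos]
        ring_nf

/-- **`‖x‖^k e^{-π‖x‖²}` is integrable** on the euclidean space `V` (comparison with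
`(1 + ‖x‖)^{-dim V - 1}`, Mathlib `integrable_one_add_norm`). [folklore] -/
theorem integrable_norm_pow_mul_exp (k : ℕ) :
    Integrable fun v : V ↦ ‖v‖ ^ k * Real.exp (-π * ‖v‖ ^ 2) := by
  set c : ℝ := Module.finrank ℝ V + 1 with hcdef
  have hc : (Module.finrank ℝ V : ℝ) < c := by rw [hcdef]; linarith
  have hc0 : 0 ≤ c := by rw [hcdef]; positivity
  refine ((integrable_one_add_norm hc).const_mul (Real.exp (((k : ℝ) + c) ^ 2 / (4 * π)))).mono'
    (by fun_prop) (Filter.Eventually.of_forall fun v ↦ ?_)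
  rw [Real.norm_eq_abs, abs_of_nonneg (by positivity)]
  exact norm_pow_mul_exp_le k hc0 v

/-! ### Polynomial multiples of the Gaussian -/

variable {ι : Type*}

/-- The **polynomial multiple `P(x) G(x)`, `P(x) = ∏_{i ∈ s} ⟨x, eᵢ⟩`, of the Gaussian
`G(x) = e^{-π‖x‖²}`** (for pairwise orthogonal `eᵢ`, `P` is harmonic; in Hecke's application the
`eᵢ` are the coordinate vectors of the real places `τ` with `p_τ = 1`, `P(x) = N(x^p)`, and `P G` is
Neukirch's `f_p(0, 0, x)`).
Ref: Neukirch, *Algebraic Number Theory*, Ch. VII §3, the functions `f_p(a, b, x)` before (3.3).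
[cite: NeukirchANT1999, Ch. VII §3 (3.3) Proposition] -/
def polyGaussian (s : Finset ι) (e : ι → V) (v : V) : ℂ :=
  (∏ i ∈ s, ((⟪v, e i⟫ : ℝ) : ℂ)) * ((Real.exp (-π * ‖v‖ ^ 2) : ℝ) : ℂ)

omit [FiniteDimensional ℝ V] [MeasurableSpace V] [BorelSpace V] in
/-- Unfolding lemma for `polyGaussian`. [folklore] -/
theorem polyGaussian_apply (s : Finset ι) (e : ι → V) (v : V) :
    polyGaussian s e v = (∏ i ∈ s, ((⟪v, e i⟫ : ℝ) : ℂ)) * ((Real.exp (-π * ‖v‖ ^ 2) : ℝ) : ℂ) :=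
  rfl

omit [FiniteDimensional ℝ V] [MeasurableSpace V] [BorelSpace V] in
/-- With no polynomial factor, `P G = G`. [folklore] -/
theorem polyGaussian_empty (e : ι → V) :
    polyGaussian ∅ e = fun v ↦ ((Real.exp (-π * ‖v‖ ^ 2) : ℝ) : ℂ) := by
  funext v; rw [polyGaussian_apply, Finset.prod_empty, one_mul]

omit [FiniteDimensional ℝ V] [MeasurableSpace V] [BorelSpace V] in
/-- Adding a linear factor: `P_{insert j s} G = ⟨x, e_j⟩ P_s G`. [folklore] -/
theorem polyGaussian_insert [DecidableEq ι] {s : Finset ι} {j : ι} (hj : j ∉ s) (e : ι → V)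
    (v : V) : polyGaussian (insert j s) e v = ((⟪v, e j⟫ : ℝ) : ℂ) * polyGaussian s e v := by
  rw [polyGaussian_apply, polyGaussian_apply, Finset.prod_insert hj, mul_assoc]

omit [FiniteDimensional ℝ V] [MeasurableSpace V] [BorelSpace V] in
/-- `P G` is continuous. [folklore] -/
theorem continuous_polyGaussian (s : Finset ι) (e : ι → V) : Continuous (polyGaussian s e) := by
  unfold polyGaussian
  refine Continuous.mul (continuous_finsetProd _ fun i _ ↦ ?_) (by fun_prop)
  exact Complex.continuous_ofReal.comp (continuous_id.inner continuous_const)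

omit [FiniteDimensional ℝ V] [MeasurableSpace V] [BorelSpace V] in
/-- `|P(x) G(x)| ≤ (∏ᵢ ‖eᵢ‖) ‖x‖^{#s} e^{-π‖x‖²}` (Cauchy–Schwarz). [folklore] -/
theorem norm_polyGaussian_le (s : Finset ι) (e : ι → V) (v : V) :
    ‖polyGaussian s e v‖ ≤ (∏ i ∈ s, ‖e i‖) * (‖v‖ ^ s.card * Real.exp (-π * ‖v‖ ^ 2)) := by
  rw [polyGaussian_apply, norm_mul, Complex.norm_real, Real.norm_eq_abs, abs_of_pos (Real.exp_pos _),
    norm_prod, ← mul_assoc]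
  refine mul_le_mul_of_nonneg_right ?_ (Real.exp_pos _).le
  calc ∏ i ∈ s, ‖((⟪v, e i⟫ : ℝ) : ℂ)‖ ≤ ∏ i ∈ s, (‖e i‖ * ‖v‖) :=
        Finset.prod_le_prod (fun i _ ↦ norm_nonneg _) fun i _ ↦ by
          rw [Complex.norm_real, Real.norm_eq_abs, mul_comm]
          exact abs_real_inner_le_norm v (e i)
    _ = (∏ i ∈ s, ‖e i‖) * ‖v‖ ^ s.card := by
        rw [Finset.prod_mul_distrib, Finset.prod_const]

/-- `P G` is integrable. [folklore] -/
theorem integrable_polyGaussian (s : Finset ι) (e : ι → V) : Integrable (polyGaussian s e) :=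
  ((integrable_norm_pow_mul_exp s.card).const_mul (∏ i ∈ s, ‖e i‖)).mono'
    (continuous_polyGaussian s e).aestronglyMeasurable
    (Filter.Eventually.of_forall (norm_polyGaussian_le s e))

/-- `‖x‖ · |P(x) G(x)|` is integrable (the hypothesis of `Real.hasFDerivAt_fourier`). [folklore] -/
theorem integrable_norm_mul_norm_polyGaussian (s : Finset ι) (e : ι → V) :
    Integrable fun v : V ↦ ‖v‖ * ‖polyGaussian s e v‖ := by
  refine ((integrable_norm_pow_mul_exp (s.card + 1)).const_mul (∏ i ∈ s, ‖e i‖)).mono'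
    (continuous_norm.mul (continuous_polyGaussian s e).norm).aestronglyMeasurable
    (Filter.Eventually.of_forall fun v ↦ ?_)
  rw [Real.norm_eq_abs, abs_of_nonneg (by positivity)]
  calc ‖v‖ * ‖polyGaussian s e v‖
      ≤ ‖v‖ * ((∏ i ∈ s, ‖e i‖) * (‖v‖ ^ s.card * Real.exp (-π * ‖v‖ ^ 2))) :=
        mul_le_mul_of_nonneg_left (norm_polyGaussian_le s e v) (norm_nonneg v)
    _ = (∏ i ∈ s, ‖e i‖) * (‖v‖ ^ (s.card + 1) * Real.exp (-π * ‖v‖ ^ 2)) := by ring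

/-- The integrand `-2πi ⟨x, ·⟩ P(x) G(x)` of the derivative of `𝓕[P G]` is integrable. [folklore] -/
theorem integrable_fourierSMulRight_polyGaussian (s : Finset ι) (e : ι → V) :
    Integrable (fourierSMulRight (innerSL ℝ) (polyGaussian s e)) := by
  refine ((integrable_norm_mul_norm_polyGaussian s e).const_mul (2 * π * ‖innerSL ℝ (E := V)‖)).mono'
    (continuous_polyGaussian s e).aestronglyMeasurable.fourierSMulRight
    (Filter.Eventually.of_forall fun v ↦ ?_)
  calc ‖fourierSMulRight (innerSL ℝ) (polyGaussian s e) v‖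
      ≤ 2 * π * ‖innerSL ℝ (E := V)‖ * ‖v‖ * ‖polyGaussian s e v‖ := norm_fourierSMulRight_le _ _ _
    _ = 2 * π * ‖innerSL ℝ (E := V)‖ * (‖v‖ * ‖polyGaussian s e v‖) := by ring

/-! ### The derivative of `P G` along an orthogonal direction -/

omit [FiniteDimensional ℝ V] [MeasurableSpace V] [BorelSpace V] in
/-- Along the line `w + t e`, with `e` orthogonal to all `eᵢ`, the polynomial `P` is constant:
`P G (w + t e) = P(w) G(w + t e)`. [folklore] -/
theorem polyGaussian_add_smul_of_orthogonal {s : Finset ι} {e : ι → V} {u : V}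
    (hu : ∀ i ∈ s, ⟪u, e i⟫ = 0) (w : V) (t : ℝ) :
    polyGaussian s e (w + t • u) =
      (∏ i ∈ s, ((⟪w, e i⟫ : ℝ) : ℂ)) * ((Real.exp (-π * ‖w + t • u‖ ^ 2) : ℝ) : ℂ) := by
  rw [polyGaussian_apply]
  congr 1
  refine Finset.prod_congr rfl fun i hi ↦ ?_
  rw [inner_add_left, real_inner_smul_left, hu i hi, mul_zero, add_zero]

omit [FiniteDimensional ℝ V] [MeasurableSpace V] [BorelSpace V] in
/-- `d/dt|_{t=0} G(w + t u) = -2π ⟨w, u⟩ G(w)` for the Gaussian `G(x) = e^{-π‖x‖²}`. [folklore] -/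
theorem hasDerivAt_gaussian_add_smul (w u : V) :
    HasDerivAt (fun t : ℝ ↦ ((Real.exp (-π * ‖w + t • u‖ ^ 2) : ℝ) : ℂ))
      (((-(2 * π * ⟪w, u⟫) : ℝ) : ℂ) * ((Real.exp (-π * ‖w‖ ^ 2) : ℝ) : ℂ)) 0 := by
  have hq : ∀ t : ℝ, ‖w + t • u‖ ^ 2 = ‖w‖ ^ 2 + 2 * ⟪w, u⟫ * t + ‖u‖ ^ 2 * t ^ 2 := by
    intro t
    rw [norm_add_sq_real, real_inner_smul_right, norm_smul, mul_pow, Real.norm_eq_abs, sq_abs]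
    ring
  have h1 : HasDerivAt (fun t : ℝ ↦ -π * (‖w‖ ^ 2 + 2 * ⟪w, u⟫ * t + ‖u‖ ^ 2 * t ^ 2))
      (-π * (2 * ⟪w, u⟫)) 0 := by
    have := ((((hasDerivAt_id (0 : ℝ)).const_mul (2 * ⟪w, u⟫)).const_add (‖w‖ ^ 2)).add
      (((hasDerivAt_id (0 : ℝ)).pow 2).const_mul (‖u‖ ^ 2))).const_mul (-π)
    simpa using this
  have h2 : HasDerivAt (fun t : ℝ ↦ Real.exp (-π * (‖w‖ ^ 2 + 2 * ⟪w, u⟫ * t + ‖u‖ ^ 2 * t ^ 2)))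
      (Real.exp (-π * ‖w‖ ^ 2) * (-π * (2 * ⟪w, u⟫))) 0 := by
    have := h1.exp
    simpa using this
  have h3 := h2.ofReal_comp
  have heq : (fun t : ℝ ↦ ((Real.exp (-π * ‖w + t • u‖ ^ 2) : ℝ) : ℂ)) =
      fun t : ℝ ↦ ((Real.exp (-π * (‖w‖ ^ 2 + 2 * ⟪w, u⟫ * t + ‖u‖ ^ 2 * t ^ 2)) : ℝ) : ℂ) := by
    funext t; rw [hq]
  rw [heq]
  convert h3 using 1
  push_cast
  ring

omit [FiniteDimensional ℝ V] [MeasurableSpace V] [BorelSpace V] in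
/-- **`∂_u (P G)(w) = -2π ⟨w, u⟩ (P G)(w)` for `u` orthogonal to the `eᵢ`** (the harmonic polynomial
`P` is constant along `w + t u`). [folklore] -/
theorem hasDerivAt_polyGaussian_add_smul {s : Finset ι} {e : ι → V} {u : V}
    (hu : ∀ i ∈ s, ⟪u, e i⟫ = 0) (w : V) :
    HasDerivAt (fun t : ℝ ↦ polyGaussian s e (w + t • u))
      (((-(2 * π * ⟪w, u⟫) : ℝ) : ℂ) * polyGaussian s e w) 0 := by
  have heq : (fun t : ℝ ↦ polyGaussian s e (w + t • u)) =
      fun t ↦ (∏ i ∈ s, ((⟪w, e i⟫ : ℝ) : ℂ)) * ((Real.exp (-π * ‖w + t • u‖ ^ 2) : ℝ) : ℂ) := by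
    funext t; exact polyGaussian_add_smul_of_orthogonal hu w t
  rw [heq, polyGaussian_apply]
  exact ((hasDerivAt_gaussian_add_smul w u).const_mul (∏ i ∈ s, ((⟪w, e i⟫ : ℝ) : ℂ))).congr_deriv
    (by ring)

/-! ### The Fourier transform of `P G` -/

/-- The scalar identity behind the induction step: `-2πi · (-i)^{n+1} r Y = (-i)^n (-2π r) Y`.
[folklore] -/
private theorem neg_two_pi_I_mul_neg_I_pow_succ (n : ℕ) (r : ℝ) (Y : ℂ) :
    -(2 * π * Complex.I) * ((-Complex.I) ^ (n + 1) * ((r : ℂ) * Y)) =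
      (-Complex.I) ^ n * (((-(2 * π * r) : ℝ) : ℂ) * Y) := by
  rw [pow_succ]
  push_cast
  have hI : Complex.I * Complex.I = -1 := Complex.I_mul_I
  linear_combination ((2 : ℂ) * π * (-Complex.I) ^ n * r * Y) * hI

/-- **`𝓕[P G] = (-i)^k P G` for `P(x) = ∏_{i ∈ s} ⟨x, eᵢ⟩` with pairwise orthogonal `eᵢ`**
(`k = #s`): Neukirch VII (3.3) Proposition, `f̂_p(a, b, ·) = [i^{Tr(p)} e^{2πi⟨a,b⟩}]⁻¹ f_p(-b, a, ·)`,
in the case `a = b = 0`, on an abstract euclidean space and for products of distinct orthogonal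
linear forms (the case `p_τ ∈ {0, 1}` at real places needed for Dirichlet characters).  Proof by
induction on `s`, differentiating `𝓕[P_s G] = (-i)^{#s} P_s G` in an orthogonal direction `e_j`
(module docstring; Neukirch differentiates the case `p = 0` in `a`).
[cite: NeukirchANT1999, Ch. VII §3 (3.3) Proposition] -/
theorem fourier_polyGaussian (s : Finset ι) (e : ι → V)
    (horth : ∀ i ∈ s, ∀ j ∈ s, i ≠ j → ⟪e i, e j⟫ = 0) :
    𝓕 (polyGaussian s e) = fun w ↦ (-Complex.I) ^ s.card * polyGaussian s e w := by
  classical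
  induction s using Finset.induction_on with
  | empty =>
    funext w
    rw [polyGaussian_empty, NumberField.fourier_gaussian_pi_eq_self, Finset.card_empty, pow_zero,
      one_mul]
  | insert j s hj ih =>
    -- the family without `j` is still orthogonal, and `e j` is orthogonal to it
    have horth' : ∀ i ∈ s, ∀ i' ∈ s, i ≠ i' → ⟪e i, e i'⟫ = 0 := fun i hi i' hi' hne ↦
      horth i (Finset.mem_insert_of_mem hi) i' (Finset.mem_insert_of_mem hi') hne
    have hu : ∀ i ∈ s, ⟪e j, e i⟫ = 0 := fun i hi ↦
      horth j (Finset.mem_insert_self j s) i (Finset.mem_insert_of_mem hi)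
        (fun h ↦ hj (h ▸ hi))
    have ih' := ih horth'
    set f := polyGaussian s e with hf
    funext w
    -- derivative of `𝓕 f = (-i)^#s f` at `w` in the direction `e j`, computed in two ways
    have hF : HasFDerivAt (fun w ↦ (-Complex.I) ^ s.card * f w)
        (𝓕 (fourierSMulRight (innerSL ℝ) f) w) w := by
      have := Real.hasFDerivAt_fourier (integrable_polyGaussian s e)
        (integrable_norm_mul_norm_polyGaussian s e) w
      rwa [ih'] at this
    have hline : HasDerivAt (fun t : ℝ ↦ w + t • e j) (e j) 0 := by
      simpa using ((hasDerivAt_id (0 : ℝ)).smul_const (e j)).const_add w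
    have hD1 : HasDerivAt (fun t : ℝ ↦ (-Complex.I) ^ s.card * f (w + t • e j))
        (𝓕 (fourierSMulRight (innerSL ℝ) f) w (e j)) 0 := by
      exact hF.comp_hasDerivAt_of_eq (0 : ℝ) hline (by simp)
    have hD2 : HasDerivAt (fun t : ℝ ↦ (-Complex.I) ^ s.card * f (w + t • e j))
        ((-Complex.I) ^ s.card * (((-(2 * π * ⟪w, e j⟫) : ℝ) : ℂ) * f w)) 0 :=
      (hasDerivAt_polyGaussian_add_smul hu w).const_mul _
    have hEq := hD1.unique hD2
    -- the left-hand side is `-2πi 𝓕[P_{insert j s} G](w)`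
    have hL : 𝓕 (fourierSMulRight (innerSL ℝ) f) w (e j) =
        -(2 * π * Complex.I) * 𝓕 (polyGaussian (insert j s) e) w := by
      rw [Real.fourier_continuousLinearMap_apply (integrable_fourierSMulRight_polyGaussian s e)]
      have hfun : (fun x ↦ fourierSMulRight (innerSL ℝ) f x (e j)) =
          (-(2 * π * Complex.I)) • polyGaussian (insert j s) e := by
        funext x
        rw [fourierSMulRight_apply, innerSL_apply_apply, Pi.smul_apply, smul_eq_mul,
          polyGaussian_insert hj, Complex.real_smul, smul_eq_mul, ← mul_assoc]
      rw [hfun]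
      exact congrFun (fourierIntegral_const_smul _ _ _ _ _) w
    rw [hL] at hEq
    -- solve for `𝓕[P_{insert j s} G](w)`
    have h2πI : -(2 * π * Complex.I) ≠ 0 := by
      simp [Real.pi_ne_zero, Complex.I_ne_zero]
    refine mul_left_cancel₀ h2πI ?_
    rw [hEq, Finset.card_insert_of_notMem hj, polyGaussian_insert hj,
      neg_two_pi_I_mul_neg_I_pow_succ]

/-! ### Translates: decay and Fourier transform of `x ↦ P(x + x₀) G(x + x₀)` -/

omit [InnerProductSpace ℝ V] [FiniteDimensional ℝ V] [MeasurableSpace V] [BorelSpace V] in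
/-- `(1 + ‖v + x₀‖)^{-c} ≤ (1 + ‖x₀‖)^c (1 + ‖v‖)^{-c}` for `c ≥ 0` (triangle inequality). [folklore] -/
theorem one_add_norm_add_rpow_neg_le {c : ℝ} (hc : 0 ≤ c) (v x₀ : V) :
    (1 + ‖v + x₀‖) ^ (-c) ≤ (1 + ‖x₀‖) ^ c * (1 + ‖v‖) ^ (-c) := by
  have h1 : 0 < 1 + ‖v + x₀‖ := by positivity
  have h2 : 0 < 1 + ‖x₀‖ := by positivity
  have h3 : 0 < 1 + ‖v‖ := by positivity
  have htri : 1 + ‖v‖ ≤ (1 + ‖x₀‖) * (1 + ‖v + x₀‖) := by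
    have := norm_le_add_norm_add v x₀
    nlinarith [norm_nonneg x₀, norm_nonneg (v + x₀), norm_nonneg v]
  rw [Real.rpow_neg h1.le, Real.rpow_neg h3.le, ← Real.inv_rpow h1.le, ← Real.inv_rpow h3.le,
    ← Real.mul_rpow h2.le (inv_nonneg.mpr h3.le)]
  refine Real.rpow_le_rpow (inv_nonneg.mpr h1.le) ?_ hc
  rw [inv_le_iff_one_le_mul₀ h1, mul_right_comm, ← div_eq_mul_inv, le_div_iff₀ h3, one_mul]
  exact htri

omit [FiniteDimensional ℝ V] [MeasurableSpace V] [BorelSpace V] in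
/-- **Decay of the translated `P G`**: `|P(v + x₀) G(v + x₀)| ≤ C (1 + ‖v‖)^{-c}` for every `c ≥ 0`.
[folklore] -/
theorem norm_polyGaussian_add_le (s : Finset ι) (e : ι → V) (x₀ : V) {c : ℝ} (hc : 0 ≤ c) :
    ∃ C : ℝ, ∀ v : V, ‖polyGaussian s e (v + x₀)‖ ≤ C * (1 + ‖v‖) ^ (-c) := by
  refine ⟨(∏ i ∈ s, ‖e i‖) * Real.exp (((s.card : ℝ) + c) ^ 2 / (4 * π)) * (1 + ‖x₀‖) ^ c,
    fun v ↦ ?_⟩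
  have hA : 0 ≤ ∏ i ∈ s, ‖e i‖ := Finset.prod_nonneg fun i _ ↦ norm_nonneg _
  calc ‖polyGaussian s e (v + x₀)‖
      ≤ (∏ i ∈ s, ‖e i‖) * (‖v + x₀‖ ^ s.card * Real.exp (-π * ‖v + x₀‖ ^ 2)) :=
        norm_polyGaussian_le s e (v + x₀)
    _ ≤ (∏ i ∈ s, ‖e i‖) * (Real.exp (((s.card : ℝ) + c) ^ 2 / (4 * π)) * (1 + ‖v + x₀‖) ^ (-c)) :=
        mul_le_mul_of_nonneg_left (norm_pow_mul_exp_le s.card hc (v + x₀)) hA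
    _ ≤ (∏ i ∈ s, ‖e i‖) * (Real.exp (((s.card : ℝ) + c) ^ 2 / (4 * π)) *
          ((1 + ‖x₀‖) ^ c * (1 + ‖v‖) ^ (-c))) := by
        gcongr
        exact one_add_norm_add_rpow_neg_le hc v x₀
    _ = (∏ i ∈ s, ‖e i‖) * Real.exp (((s.card : ℝ) + c) ^ 2 / (4 * π)) * (1 + ‖x₀‖) ^ c *
          (1 + ‖v‖) ^ (-c) := by ring

omit [FiniteDimensional ℝ V] [MeasurableSpace V] [BorelSpace V] in
/-- The translate `v ↦ P(v + x₀) G(v + x₀)` is continuous. [folklore] -/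
theorem continuous_polyGaussian_add (s : Finset ι) (e : ι → V) (x₀ : V) :
    Continuous fun v ↦ polyGaussian s e (v + x₀) :=
  (continuous_polyGaussian s e).comp (continuous_id.add continuous_const)

/-- **Fourier transform of the translate**: `𝓕[P G(· + x₀)](ξ) = e^{2πi⟨x₀, ξ⟩} (-i)^k P(ξ) G(ξ)`
— Neukirch VII (3.3) Proposition, `f̂_p(a, b, ·) = [i^{Tr(p)} e^{2πi⟨a,b⟩}]⁻¹ f_p(-b, a, ·)`, in the
case `a = x₀`, `b = 0` (`f_p(0, x₀, ξ) = N(ξ^p) e^{-π⟨ξ,ξ⟩ + 2πi⟨x₀,ξ⟩}`); from `fourier_polyGaussian`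
and translation ↦ phase (Mathlib `VectorFourier.fourierIntegral_comp_add_right`).
[cite: NeukirchANT1999, Ch. VII §3 (3.3) Proposition] -/
theorem fourier_polyGaussian_add (s : Finset ι) (e : ι → V)
    (horth : ∀ i ∈ s, ∀ j ∈ s, i ≠ j → ⟪e i, e j⟫ = 0) (x₀ : V) :
    𝓕 (fun v ↦ polyGaussian s e (v + x₀)) =
      fun w ↦ ((𝐞 ⟪x₀, w⟫ : ℂ)) * ((-Complex.I) ^ s.card * polyGaussian s e w) := by
  have h := VectorFourier.fourierIntegral_comp_add_right 𝐞 volume (innerₗ V) (polyGaussian s e) x₀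
  have h2 := fourier_polyGaussian s e horth
  funext w
  have hw := congrFun h w
  have h2w := congrFun h2 w
  change VectorFourier.fourierIntegral 𝐞 volume (innerₗ V) (polyGaussian s e) w = _ at h2w
  change VectorFourier.fourierIntegral 𝐞 volume (innerₗ V) (polyGaussian s e ∘ fun v ↦ v + x₀) w = _
  rw [hw, h2w, innerₗ_apply_apply, Circle.smul_def, smul_eq_mul]

end Literature.NumberTheory.LFunctions.Fourier

end
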